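import Summits.Parity.GeneralizedHardyLittlewood.Theorems.LeeYangFibresCellParityLawP2Defs
import Literature.NumberTheory.Sieve.RosserSieveTheoremOneHalfLt
import Literature.NumberTheory.Sieve.LinearSieveConstant
import Literature.NumberTheory.Sieve.SieveFunctionsBridge
import HarnessLib

/-!
# Route `LeeYangFibres`, crux `CellParityLaw` (stmt-Parity-14109), line `section-annihilator`:
# the registered stub `stub_primeUpperBound` — the linear-sieve upper bound for the primes of the sequence

Skeleton v18 (lead c5). This file proves `PrimeUpperBound` (vocabulary file
`LeeYangFibresCellParityLawP2Defs`): for kernel-admissible data `(𝒜, x, η, Λ, w₀, R)` with `x ≥ x₀`,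
`z ∈ [x^{1/(u+1)}, x^{1/2}]` and parameters in range,

  `C₁ = Σ_{q ≤ x, P⁻(q) > z, Ω(q) = 1} a_q ≤ 2 T + kernelErr C (1/3) 0 𝒜 x z η Λ R`,
  `T = primeMain 𝒜 x z = e^γ V(z) A(x) / u'`, `u' = log x / log z`

(Bombieri's `δ_x ≤ 2`). Proof (Iwaniec's linear sieve, [IwaniecActaArith1980] Theorem 1 with `κ = 1`):

* the weights are supported on `(x/Λ, x]` and `x/Λ ≥ x^{1-η} ≥ x^{1/2}`, so every prime counted by `C₁`
  exceeds `x^{1/2}` and is coprime to `P(x^{1/2})`: `C₁ ≤ S(𝒜, x^{1/2}; x)` (`roughCellSum_one_le_sifted`);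
* `Iwaniec1980_thm1_upper_of_half_lt` (uniform over `Ω(1, L')`) at level `y = x^{1-η}`, sifting by the
  primes `< x^{1/2}`: `s = log y / log x^{1/2} = 2(1-η) ∈ (0, 3]`, `F(s) = 2e^γ/s = e^γ/(1-η)`
  (`upperSieveFun_one_eq_holds`), error `C_I (log y)^{-1/3} ≤ |C_I| (log z)^{-1/3}`;
* the remainder sum over `d < y`, `d ∣ P(x^{1/2})` is a sub-sum of the strong Type-I sum (`StrongTypeI` with
  the constant selection `y_d = x`), hence `≤ R`;
* the two-sided Mertens clause of `KernelAdmissible` at `(w, z') = (z, x^{1/2})` converts `V(x^{1/2})` into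
  `V(z) · (2/u') (1 - L'/log z)⁻¹` (`densityProduct_split`), and
  `(1 - L'/log z)⁻¹ (1-η)⁻¹ ≤ 1 + 4 (L'/log z + η)`, `L'/log z ≤ L' (log z)^{-1/3}`, `η ≤ η^{1/3}`.

Constants: `κ = 1/3`, `η₀ = 1/(4u)`, `A₂ = 0`, `C = 4e^γ(|L'| + 1) + 2|C_I| + 1`,
`x₀ = exp((u+1)(2|L'| + 4))`.

References: H. Iwaniec, *Rosser's sieve*, Acta Arith. 36 (1980) 171–202, Theorem 1 [IwaniecActaArith1980];
E. Bombieri, Rend. Accad. Naz. XL (5) 1/2 (1975/76) 243–269, §1 [BombieriAsymptoticSieve1976].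
-/

noncomputable section

open scoped BigOperators Classical
open Finset Literature.NumberTheory.Sieve

namespace Summit.Parity.GeneralizedHardyLittlewood.Cruxes.CellParityLaw.SectionAnnihilator

namespace PrimeUpperBoundAux

/-- **The rough prime cell is sifted mass.** If the weights vanish at every `q ≤ w`, then
`C₁(𝒜; x, z) ≤ S(𝒜, P(w); x)`: a `q` with `Ω(q) = 1` is a prime, and a prime `q > w` is coprime to
`P(w) = ∏_{p < w} p`. (A sub-sum of nonnegative terms.) -/
theorem roughCellSum_one_le_sifted (𝒜 : SieveSequence) (x z w : ℝ)
    (hsupp : ∀ q : ℕ, (q : ℝ) ≤ w → 𝒜.a q = 0) :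
    roughCellSum 𝒜 x z 1 ≤ 𝒜.sifted x (primesProdBelow w) := by
  unfold roughCellSum SieveSequence.sifted
  rw [Finset.sum_filter, Finset.sum_filter]
  refine Finset.sum_le_sum fun q _ => ?_
  split_ifs with h1 h2 h2
  · exact le_rfl
  · -- `q` is counted by the cell but not coprime to `P(w)`: then `a_q = 0`
    suffices h0 : 𝒜.a q = 0 by rw [h0]
    by_contra hane
    apply h2
    have hqprime : q.Prime := ArithmeticFunction.cardFactors_eq_one_iff_prime.mp h1.2
    have hwq : w < (q : ℝ) := lt_of_not_ge fun h => hane (hsupp q h)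
    rw [coprime_primesProdBelow_iff]
    intro p hp hpq
    obtain ⟨hpw, hpprime⟩ := Nat.mem_primesBelow.mp hp
    have hpq' : p = q := (Nat.prime_dvd_prime_iff_eq hpprime hqprime).mp hpq
    have hlt : (p : ℝ) < w := Nat.lt_ceil.mp hpw
    rw [hpq'] at hlt
    exact lt_irrefl _ (hlt.trans hwq)
  · exact 𝒜.a_nonneg q
  · exact le_rfl

/-- **Splitting the density product at `z`**: for `z ≤ z'`,
`V(z') = (∏_{z ≤ p < z'} (1 - g(p))) · V(z)`, where `V(w) = ∏_{p < w} (1 - g(p))`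
(`SieveSequence.densityProduct` over `primesProdBelow w`, whose prime factors are the primes `< ⌈w⌉₊`). -/
theorem densityProduct_split (𝒜 : SieveSequence) {z z' : ℝ} (hzz' : z ≤ z') :
    𝒜.densityProduct (primesProdBelow z') =
      (∏ p ∈ (Nat.primesBelow ⌈z'⌉₊).filter (fun p : ℕ => z ≤ (p : ℝ)), (1 - 𝒜.density p)) *
        𝒜.densityProduct (primesProdBelow z) := by
  unfold SieveSequence.densityProduct
  rw [primeFactors_primesProdBelow, primeFactors_primesProdBelow,
    ← Finset.prod_filter_mul_prod_filter_not (Nat.primesBelow ⌈z'⌉₊) (fun p : ℕ => z ≤ (p : ℝ))]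
  congr 1
  refine Finset.prod_congr ?_ fun _ _ => rfl
  ext p
  simp only [Finset.mem_filter, Nat.mem_primesBelow, not_le]
  constructor
  · rintro ⟨⟨-, hp⟩, hlt⟩
    exact ⟨Nat.lt_ceil.mpr hlt, hp⟩
  · rintro ⟨hlt, hp⟩
    have h := Nat.lt_ceil.mp hlt
    exact ⟨⟨Nat.lt_ceil.mpr (h.trans_le hzz'), hp⟩, h⟩

/-- The elementary inequality behind the loss `(1 - a)⁻¹ (1 - η)⁻¹ ≤ 1 + 4(a + η)` for `0 ≤ a ≤ 1/2`,
`0 ≤ η ≤ 1/8`. -/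
theorem inv_mul_inv_le {a η : ℝ} (ha0 : 0 ≤ a) (ha2 : a ≤ 1 / 2) (hη0 : 0 ≤ η) (hη8 : η ≤ 1 / 8) :
    (1 - a)⁻¹ * (1 - η)⁻¹ ≤ 1 + 4 * (a + η) := by
  have h1a : 0 < 1 - a := by linarith
  have h1η : 0 < 1 - η := by linarith
  rw [← mul_inv, inv_eq_one_div, div_le_iff₀ (mul_pos h1a h1η)]
  nlinarith [mul_nonneg ha0 hη0, mul_nonneg (mul_nonneg ha0 hη0) ha0,
    mul_nonneg (mul_nonneg ha0 hη0) hη0, mul_nonneg ha0 (sub_nonneg.mpr ha2),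
    mul_nonneg ha0 (sub_nonneg.mpr hη8), mul_nonneg hη0 (sub_nonneg.mpr hη8)]

end PrimeUpperBoundAux

open PrimeUpperBoundAux in
/-- **`stub_primeUpperBound`** (registered stub of skeleton v18, line `section-annihilator`): the
linear-sieve upper bound for the primes of a kernel-admissible sequence,
`Σ_{z < p ≤ x} a_p ≤ 2 T + C (η^{1/3} + (log z)^{-1/3} + log(2Λ)/log z) V(z) A(x) + C (R + x/z)` —
Iwaniec's Theorem 1 (`κ = 1`) at `s = 2(1-η)` with `F(s) = 2e^γ/s`, sifting the support `(x/Λ, x]` by the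
primes `< x^{1/2}` at level `x^{1-η}`, the strong Type-I bound for the remainders, and the two-sided Mertens
clause to pass from `V(x^{1/2})` to `V(z) · 2/u'`. Bombieri's `δ_x ≤ 2`. -/
theorem stub_primeUpperBound : PrimeUpperBound := by
  intro u A₁ L' hu
  -- Iwaniec's linear sieve (`κ = 1`), uniform over the class `Ω(1, L')`
  obtain ⟨Bd, hBd, hBC⟩ := Iwaniec1980_thm1_upper_of_half_lt (κ := 1) (by norm_num)
  obtain ⟨CI, hCI⟩ := hBC L'
  set G : ℝ := Real.exp Real.eulerMascheroniConstant with hG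
  have hG0 : 0 < G := Real.exp_pos _
  -- the constants
  set C : ℝ := 4 * G * (|L'| + 1) + 2 * |CI| + 1 with hC
  have hAL : 0 ≤ |L'| := abs_nonneg _
  have hACI : 0 ≤ |CI| := abs_nonneg _
  have hGL : 0 ≤ G * |L'| := mul_nonneg hG0.le hAL
  have hC4G : 4 * G ≤ C := by rw [hC]; linarith
  have hC1 : 1 ≤ C := by linarith
  have hu2 : (2 : ℝ) ≤ u := by exact_mod_cast hu
  have hu10 : (0 : ℝ) < (u : ℝ) + 1 := by linarith
  refine ⟨1 / 3, C, 1 / (4 * (u : ℝ)), 0, Real.exp (((u : ℝ) + 1) * (2 * |L'| + 4)),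
    by norm_num, by linarith, by positivity, ?_⟩
  intro 𝒜 x z η Λ w₀ R hx₀ hzlo hzhi hKR hKA
  obtain ⟨hηlo, hηhi, hΛ1, hΛhi, hw₀2, hw₀hi⟩ := hKR
  obtain ⟨-, -, hsupp, hsize, -, hdim, hMert, hTypeI⟩ := hKA
  rw [StrongTypeI] at hTypeI
  have hL'0 : 0 ≤ L' := hdim.nonneg
  have habsL : |L'| = L' := abs_of_nonneg hL'0
  /- 1. ranges of `x`, `z`, `η` -/
  have hx0 : 0 < x := (Real.exp_pos _).trans_le hx₀
  obtain ⟨lx, hlx⟩ : ∃ lx : ℝ, lx = Real.log x := ⟨_, rfl⟩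
  have hlxge : ((u : ℝ) + 1) * (2 * |L'| + 4) ≤ lx := by
    rw [hlx, ← Real.log_exp (((u : ℝ) + 1) * (2 * |L'| + 4))]
    exact Real.log_le_log (Real.exp_pos _) hx₀
  have hlx12 : 12 ≤ lx := by
    have h4 : ((u : ℝ) + 1) * 4 ≤ ((u : ℝ) + 1) * (2 * |L'| + 4) :=
      mul_le_mul_of_nonneg_left (by linarith) hu10.le
    linarith
  have hlx0 : 0 < lx := by linarith
  have hlogx0 : 0 < Real.log x := by rw [← hlx]; exact hlx0
  have hx1 : 1 < x := by
    by_contra h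
    have := Real.log_nonpos hx0.le (not_lt.mp h)
    linarith
  have hx1' : 1 ≤ x := hx1.le
  have hz0 : 0 < z := (Real.rpow_pos_of_pos hx0 _).trans_le hzlo
  obtain ⟨lz, hlz⟩ : ∃ lz : ℝ, lz = Real.log z := ⟨_, rfl⟩
  have hlzlo : lx / ((u : ℝ) + 1) ≤ lz := by
    have h := Real.log_le_log (Real.rpow_pos_of_pos hx0 _) hzlo
    rw [Real.log_rpow hx0, ← hlx, ← hlz] at h
    calc lx / ((u : ℝ) + 1) = 1 / ((u : ℝ) + 1) * lx := by ring
      _ ≤ lz := h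
  have hlzhi : lz ≤ lx / 2 := by
    have h := Real.log_le_log hz0 hzhi
    rw [Real.log_rpow hx0, ← hlx, ← hlz] at h
    linarith
  have hlz4 : 2 * |L'| + 4 ≤ lz := by
    refine le_trans ?_ hlzlo
    rw [le_div_iff₀ hu10]
    linarith
  have hlz1 : 1 ≤ lz := by linarith
  have hlz0 : 0 < lz := by linarith
  -- `η`
  have hη0 : 0 < η := (Real.rpow_pos_of_pos hlogx0 _).trans_le hηlo
  have hη8 : η ≤ 1 / 8 :=
    hηhi.trans (one_div_le_one_div_of_le (by norm_num) (by linarith))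
  have hη1 : η < 1 := by linarith
  -- the two sieve parameters `x^{1/2}` and `y = x^{1-η}`
  set xh : ℝ := x ^ (1 / 2 : ℝ) with hxh
  set y : ℝ := x ^ (1 - η) with hy
  have hxhpos : 0 < xh := Real.rpow_pos_of_pos hx0 _
  have hlxh : Real.log xh = 1 / 2 * lx := by rw [hxh, Real.log_rpow hx0, ← hlx]
  have hly : Real.log y = (1 - η) * lx := by rw [hy, Real.log_rpow hx0, ← hlx]
  have hxη : x ^ η ≤ x ^ (1 / ((u : ℝ) + 1)) :=
    Real.rpow_le_rpow_of_exponent_le hx1'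
      (hηhi.trans (one_div_le_one_div_of_le hu10 (by linarith)))
  have hw₀z : w₀ ≤ z := hw₀hi.trans (hxη.trans hzlo)
  have hz2 : 2 ≤ z := hw₀2.trans hw₀z
  have hzxh : z ≤ xh := hzhi
  have hxh2 : 2 ≤ xh := hz2.trans hzxh
  have hxhx : xh ≤ x := Real.rpow_le_self_of_one_le hx1' (by norm_num)
  have hxhy : xh ≤ y := Real.rpow_le_rpow_of_exponent_le hx1' (by linarith)
  have hΛ0 : 0 < Λ := by linarith
  have hyle : y ≤ x / Λ := by
    have h1 : y = x / x ^ η := by rw [hy, Real.rpow_sub hx0, Real.rpow_one]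
    rw [h1]
    exact div_le_div_of_nonneg_left hx0.le hΛ0 hΛhi
  have hsuppxh : ∀ q : ℕ, (q : ℝ) ≤ xh → 𝒜.a q = 0 := fun q hq =>
    hsupp q (hq.trans (hxhy.trans hyle))
  /- 2. the cell is sifted mass -/
  have hC1S : roughCellSum 𝒜 x z 1 ≤ 𝒜.sifted x (primesProdBelow xh) :=
    roughCellSum_one_le_sifted 𝒜 x z xh hsuppxh
  /- 3. Iwaniec's theorem -/
  set A : ℝ := 𝒜.size x with hA
  have hA0 : 0 ≤ A := by
    rw [hA, hsize]
    exact Finset.sum_nonneg fun n _ => 𝒜.a_nonneg n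
  set Vh : ℝ := 𝒜.densityProduct (primesProdBelow xh) with hVh
  set V : ℝ := 𝒜.densityProduct (primesProdBelow z) with hV
  set lam : ℝ := Real.log y ^ (-(1 / 3 : ℝ)) with hlam
  have hlogy0 : 0 < Real.log y := by rw [hly]; exact mul_pos (by linarith) hlx0
  have hlam0 : 0 ≤ lam := Real.rpow_nonneg hlogy0.le _
  have hs : Real.log y / Real.log xh = 2 * (1 - η) := by
    rw [hly, hlxh, div_eq_iff (by positivity)]
    ring
  have hF : Bd.1 (2 * (1 - η)) = G / (1 - η) := by
    rw [hBd.eqOn_iwaniecSieveFun.1 (Set.mem_Ioi.mpr (by linarith : (0 : ℝ) < 2 * (1 - η))),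
      ← upperSieveFun_one, upperSieveFun_one_eq_holds ⟨by linarith, by linarith⟩, hG]
    exact mul_div_mul_left _ _ two_ne_zero
  -- the remainder sum is a sub-sum of the strong Type-I sum with the selection `y_d = x`
  have hT := hTypeI (fun _ => x) fun _ => le_rfl
  have hR0 : 0 ≤ R := le_trans (Finset.sum_nonneg fun _ _ => abs_nonneg _) hT
  have hRs : ∑ d ∈ (Finset.range ⌈y⌉₊).filter (· ∣ primesProdBelow xh), |𝒜.remainder d x| ≤ R := by
    refine le_trans (Finset.sum_le_sum_of_subset_of_nonneg (fun d hd => ?_)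
      fun _ _ _ => abs_nonneg _) hT
    obtain ⟨hdr, hdP⟩ := Finset.mem_filter.mp hd
    have hd0 : d ≠ 0 := fun h => by
      rw [h, zero_dvd_iff] at hdP
      exact primesProdBelow_ne_zero xh hdP
    refine Finset.mem_filter.mpr ⟨Finset.mem_Icc.mpr ⟨Nat.one_le_iff_ne_zero.mpr hd0, ?_⟩,
      (squarefree_primesProdBelow xh).squarefree_of_dvd hdP⟩
    have h1 : d < ⌈y⌉₊ := Finset.mem_range.mp hdr
    have h2 : ⌈y⌉₊ ≤ ⌊y⌋₊ + 1 := Nat.ceil_le_floor_add_one y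
    change d ≤ ⌊y⌋₊
    omega
  have hS : 𝒜.sifted x (primesProdBelow xh) ≤ A * Vh * (G / (1 - η) + |CI| * lam) + R := by
    have hI := hCI 𝒜 hdim x y xh hxh2 hxhy hA0
    rw [hs, hF] at hI
    have h1 : A * Vh * (G / (1 - η) + CI * lam) ≤ A * Vh * (G / (1 - η) + |CI| * lam) := by
      have hVh0 : 0 ≤ Vh := by
        rw [hVh]
        unfold SieveSequence.densityProduct
        exact Finset.prod_nonneg fun p hp =>
          sub_nonneg.mpr (hdim.1 p (Nat.prime_of_mem_primeFactors hp)).2.le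
      have hCIlam : CI * lam ≤ |CI| * lam := mul_le_mul_of_nonneg_right (le_abs_self CI) hlam0
      exact mul_le_mul_of_nonneg_left (by linarith) (mul_nonneg hA0 hVh0)
    linarith
  /- 4. Mertens: `V(x^{1/2}) = Q · V(z)` with `Q ≤ (2 log z/log x) (1 - L'/log z)⁻¹` -/
  have hM := hMert z xh hw₀z hzxh hxhx
  rw [Finset.prod_inv_distrib] at hM
  set Q : ℝ := ∏ p ∈ (Nat.primesBelow ⌈xh⌉₊).filter (fun p : ℕ => z ≤ (p : ℝ)), (1 - 𝒜.density p)
    with hQ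
  have hVsplit : Vh = Q * V := by
    rw [hVh, hQ, hV]
    exact densityProduct_split 𝒜 hzxh
  have hQpos : 0 < Q := by
    rw [hQ]
    exact Finset.prod_pos fun p hp =>
      sub_pos.mpr (hdim.1 p (Nat.prime_of_mem_primesBelow (Finset.mem_filter.mp hp).1)).2
  have hV0 : 0 ≤ V := by
    rw [hV]
    unfold SieveSequence.densityProduct
    exact Finset.prod_nonneg fun p hp =>
      sub_nonneg.mpr (hdim.1 p (Nat.prime_of_mem_primeFactors hp)).2.le
  obtain ⟨ρ, hρ⟩ : ∃ ρ : ℝ, ρ = 2 * lz / lx := ⟨_, rfl⟩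
  obtain ⟨a, ha⟩ : ∃ a : ℝ, a = L' / lz := ⟨_, rfl⟩
  have hρ0 : 0 < ρ := by rw [hρ]; positivity
  have hρ1 : ρ ≤ 1 := by rw [hρ, div_le_one hlx0]; linarith
  have ha0 : 0 ≤ a := by rw [ha]; positivity
  have ha2 : a ≤ 1 / 2 := by
    rw [ha, div_le_iff₀ hlz0]
    linarith
  have h1a : 0 < 1 - a := by linarith
  have hQle : Q ≤ ρ * (1 - a)⁻¹ := by
    have hlhs : Real.log xh / Real.log z * (1 - L' / Real.log z) = (ρ * (1 - a)⁻¹)⁻¹ := by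
      rw [mul_inv, inv_inv, hρ, ha, inv_div, hlxh, ← hlz]
      ring
    rw [hlhs] at hM
    exact (inv_le_inv₀ (mul_pos hρ0 (inv_pos.mpr h1a)) hQpos).mp hM
  /- 5. the scalar inequality -/
  have hη3 : 0 ≤ η ^ (1 / 3 : ℝ) := Real.rpow_nonneg hη0.le _
  have hlz3 : 0 ≤ lz ^ (-(1 / 3 : ℝ)) := Real.rpow_nonneg hlz0.le _
  have hlam_le : lam ≤ lz ^ (-(1 / 3 : ℝ)) := by
    rw [hlam]
    refine Real.rpow_le_rpow_of_nonpos hlz0 ?_ (by norm_num)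
    rw [hly]
    have h := mul_nonneg hlx0.le (show (0 : ℝ) ≤ 1 / 2 - η by linarith)
    linarith
  have ha_le : a ≤ L' * lz ^ (-(1 / 3 : ℝ)) := by
    have h1 : lz ^ (-(1 : ℝ)) ≤ lz ^ (-(1 / 3 : ℝ)) :=
      Real.rpow_le_rpow_of_exponent_le hlz1 (by norm_num)
    rw [Real.rpow_neg_one] at h1
    calc a = L' * lz⁻¹ := by rw [ha, div_eq_mul_inv]
      _ ≤ L' * lz ^ (-(1 / 3 : ℝ)) := mul_le_mul_of_nonneg_left h1 hL'0
  have hη_le : η ≤ η ^ (1 / 3 : ℝ) := Real.self_le_rpow_of_le_one hη0.le hη1.le (by norm_num)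
  have hinv1 : (1 - a)⁻¹ ≤ 2 := by
    rw [inv_eq_one_div, div_le_iff₀ h1a]
    linarith
  have hinv2 : (1 - a)⁻¹ * (1 - η)⁻¹ ≤ 1 + 4 * (a + η) := inv_mul_inv_le ha0 ha2 hη0.le hη8
  have hscal : (G / (1 - η) + |CI| * lam) * (ρ * (1 - a)⁻¹) ≤
      ρ * G + C * (η ^ (1 / 3 : ℝ) + lz ^ (-(1 / 3 : ℝ))) := by
    have e1 : (G / (1 - η) + |CI| * lam) * (ρ * (1 - a)⁻¹) =
        ρ * G * ((1 - a)⁻¹ * (1 - η)⁻¹) + ρ * (|CI| * lam) * (1 - a)⁻¹ := by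
      rw [div_eq_mul_inv]
      ring
    rw [e1]
    have h1 : ρ * G * ((1 - a)⁻¹ * (1 - η)⁻¹) ≤ ρ * G * (1 + 4 * (a + η)) :=
      mul_le_mul_of_nonneg_left hinv2 (mul_nonneg hρ0.le hG0.le)
    have h2 : ρ * (|CI| * lam) * (1 - a)⁻¹ ≤ ρ * (|CI| * lam) * 2 :=
      mul_le_mul_of_nonneg_left hinv1 (mul_nonneg hρ0.le (mul_nonneg hACI hlam0))
    have h3 : ρ * (G * (a + η)) ≤ G * (a + η) :=
      mul_le_of_le_one_left (mul_nonneg hG0.le (by linarith)) hρ1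
    have h4 : ρ * (|CI| * lam) ≤ |CI| * lam :=
      mul_le_of_le_one_left (mul_nonneg hACI hlam0) hρ1
    have h5 : G * (a + η) ≤ G * (L' * lz ^ (-(1 / 3 : ℝ)) + η ^ (1 / 3 : ℝ)) :=
      mul_le_mul_of_nonneg_left (add_le_add ha_le hη_le) hG0.le
    have h6 : |CI| * lam ≤ |CI| * lz ^ (-(1 / 3 : ℝ)) := mul_le_mul_of_nonneg_left hlam_le hACI
    have h7 : 0 ≤ (C - 4 * G) * η ^ (1 / 3 : ℝ) := mul_nonneg (by linarith) hη3
    have h8 : 0 ≤ (C - 4 * G * L' - 2 * |CI|) * lz ^ (-(1 / 3 : ℝ)) := by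
      refine mul_nonneg ?_ hlz3
      rw [hC, habsL]
      linarith
    linarith
  /- 6. assembly -/
  have hmain : roughCellSum 𝒜 x z 1 ≤
      A * V * (ρ * G + C * (η ^ (1 / 3 : ℝ) + lz ^ (-(1 / 3 : ℝ)))) + R := by
    have hP0 : 0 ≤ A * V * (G / (1 - η) + |CI| * lam) :=
      mul_nonneg (mul_nonneg hA0 hV0)
        (add_nonneg (div_nonneg hG0.le (by linarith)) (mul_nonneg hACI hlam0))
    calc roughCellSum 𝒜 x z 1 ≤ 𝒜.sifted x (primesProdBelow xh) := hC1S
      _ ≤ A * Vh * (G / (1 - η) + |CI| * lam) + R := hS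
      _ = A * V * (G / (1 - η) + |CI| * lam) * Q + R := by rw [hVsplit]; ring
      _ ≤ A * V * (G / (1 - η) + |CI| * lam) * (ρ * (1 - a)⁻¹) + R := by
          have := mul_le_mul_of_nonneg_left hQle hP0
          linarith
      _ = A * V * ((G / (1 - η) + |CI| * lam) * (ρ * (1 - a)⁻¹)) + R := by ring
      _ ≤ A * V * (ρ * G + C * (η ^ (1 / 3 : ℝ) + lz ^ (-(1 / 3 : ℝ)))) + R := by
          have := mul_le_mul_of_nonneg_left hscal (mul_nonneg hA0 hV0)
          linarith
  have hextra : 0 ≤ C * (Real.log (2 * Λ) / lz) * (V * A) :=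
    mul_nonneg (mul_nonneg (by linarith) (div_nonneg (Real.log_nonneg (by linarith)) hlz0.le))
      (mul_nonneg hV0 hA0)
  have hxz : 0 ≤ C * (x / z) := mul_nonneg (by linarith) (div_nonneg hx0.le hz0.le)
  have hCR : 0 ≤ (C - 1) * R := mul_nonneg (by linarith) hR0
  have e2 : 2 * (G * V * A / (lx / lz)) = A * V * (ρ * G) := by
    rw [hρ, div_div_eq_mul_div]
    ring
  unfold primeMain kernelErr
  rw [← hG, ← hlx, ← hlz, ← hV, ← hA, pow_zero, mul_one, e2]
  linarith [hmain, hextra, hxz, hCR]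

end Summit.Parity.GeneralizedHardyLittlewood.Cruxes.CellParityLaw.SectionAnnihilator

end
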